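import Summits.NavierStokesRegularity.NavierStokesRegularity.Theorems.ExtremiserTransienceNearExtremalTransienceExtremiserLiouvilleConstantSpeedBlowDownWindow
import Mathlib.MeasureTheory.Integral.MeanInequalities
import Mathlib.MeasureTheory.Integral.IntervalIntegral.FundThmCalculus
import HarnessLib

/-!
# Crux `ExtremiserTransience.NearExtremalTransience` (stmt-NavierStokesRegularity-21883), line `extremiser_liouville`,
# stub K1b — RELLICH TOOLS: `L²` translation and mollification estimates by the `L²` norm of the gradient

`--supports stmt-NavierStokesRegularity-21883` (helper).  Author: prover seat `ns-el-k1b` (g6).  Record §8 case (β) kills the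
sub-conical jet through `…BlowDownWindow` PROVIDED the blow-downs converge strongly on a window; (β) itself only supplies uniform
`H¹` bounds there, and Mathlib has no Rellich–Kondrachov theorem.  This file and `…ConstantSpeedRellich` supply the smooth,
self-contained version that suffices: for `f ∈ C¹(ℝ³;ℝ³)`,

* `enorm_sub_translate_sq_le` : `‖f x − f(x − t)‖ₑ² ≤ ‖t‖² ∫⁻_{s∈[0,1]} ‖Df(x − t + s t)‖ₑ²` (FTC along the segment + Jensen);
* `lintegral_ball_sub_translate_sq_le` : `∫⁻_{B(x₀,L)} ‖f − f(· − t)‖ₑ² ≤ ‖t‖² ∫⁻_{B(x₀,L+‖t‖)} ‖Df‖ₑ²` (Tonelli + translation);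
* `lintegral_ball_sub_normed_convolution_sq_le` : `∫⁻_{B(x₀,L)} ‖f − φ.normed ⋆ f‖ₑ² ≤ rOut² ∫⁻_{B(x₀,L+rOut)} ‖Df‖ₑ²` (Jensen for
  the probability density `φ.normed`).

(Evans, *PDE*, §5.7/§5.8.2 pattern.)  WHAT THIS IS NOT: K1b is NOT proved; nothing here proves NS regularity. [folklore]
-/

noncomputable section

open Set Filter Topology MeasureTheory Metric Function ContinuousLinearMap
open scoped ENNReal NNReal Topology InnerProductSpace RealInnerProductSpace ContDiff Convolution
open Literature.Analysis.FluidPDE Literature.Analysis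

namespace Summit.NavierStokesRegularity.NavierStokesRegularity.Theorems

-- the problem directory repeats the summit name (`NavierStokesRegularity/NavierStokesRegularity`)
set_option linter.dupNamespace false

namespace ExtremiserLiouville

open DepletionLadder.KStar DepletionLadder.KStar.HalfSpace

variable {f : E3 → E3}

/-- Jensen on `[0,1]` in `ℝ≥0∞` form: `(∫⁻_{[0,1]} g)² ≤ ∫⁻_{[0,1]} g²`. [folklore] -/
theorem lintegral_Icc_sq_le {g : ℝ → ℝ≥0∞} (hg : AEMeasurable g (volume.restrict (Icc (0 : ℝ) 1))) :
    (∫⁻ s in Icc (0 : ℝ) 1, g s) ^ 2 ≤ ∫⁻ s in Icc (0 : ℝ) 1, g s ^ 2 := by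
  have hH := ENNReal.lintegral_mul_le_Lp_mul_Lq (volume.restrict (Icc (0 : ℝ) 1)) Real.HolderConjugate.two_two hg
    (g := fun _ => 1) aemeasurable_const
  simp only [Pi.mul_apply, mul_one, lintegral_const, Measure.restrict_apply MeasurableSet.univ,
    univ_inter, Real.volume_Icc, sub_zero, ENNReal.ofReal_one, ENNReal.rpow_two, one_pow, ENNReal.one_rpow] at hH
  calc (∫⁻ s in Icc (0 : ℝ) 1, g s) ^ 2 ≤ ((∫⁻ s in Icc (0 : ℝ) 1, g s ^ 2) ^ (1 / (2 : ℝ))) ^ 2 := pow_le_pow_left' hH 2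
    _ = ∫⁻ s in Icc (0 : ℝ) 1, g s ^ 2 := by rw [← ENNReal.rpow_natCast, ← ENNReal.rpow_mul]; norm_num

/-- **Translation estimate, pointwise**: `‖f x − f(x − t)‖ₑ² ≤ ‖t‖² · ∫⁻_{s∈[0,1]} ‖Df(x − t + s t)‖ₑ²` for `f ∈ C¹`. [folklore] -/
theorem enorm_sub_translate_sq_le (hf : ContDiff ℝ 1 f) (x t : E3) :
    ‖f x - f (x - t)‖ₑ ^ 2 ≤ ENNReal.ofReal (‖t‖ ^ 2) * ∫⁻ s in Icc (0 : ℝ) 1, ‖fderiv ℝ f (x - t + s • t)‖ₑ ^ 2 := by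
  -- FTC along the segment `s ↦ x − t + s t`
  set γ : ℝ → E3 := fun s => f (x - t + s • t) with hγ
  have hfd : Differentiable ℝ f := hf.differentiable one_ne_zero
  have hderiv : ∀ s, HasDerivAt γ (fderiv ℝ f (x - t + s • t) t) s := by
    intro s
    have hl : HasDerivAt (fun s : ℝ => x - t + s • t) t s := by
      have h := ((hasDerivAt_id s).smul_const t).const_add (x - t)
      simpa using h
    exact (hfd (x - t + s • t)).hasFDerivAt.comp_hasDerivAt s hl
  have hl2 : Continuous fun s : ℝ => x - t + s • t := by fun_prop
  have hcont : Continuous fun s : ℝ => fderiv ℝ f (x - t + s • t) t :=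
    ((hf.continuous_fderiv one_ne_zero).comp hl2).clm_apply continuous_const
  have hftc : ∫ s in (0 : ℝ)..1, fderiv ℝ f (x - t + s • t) t = f x - f (x - t) := by
    rw [intervalIntegral.integral_eq_sub_of_hasDerivAt (fun s _ => hderiv s) (hcont.intervalIntegrable 0 1)]
    simp [hγ]
  rw [← hftc, intervalIntegral.integral_of_le zero_le_one]
  -- `‖∫‖ₑ ≤ ∫⁻ ‖·‖ₑ`, then Jensen
  have h1 : ‖∫ s in Ioc (0 : ℝ) 1, fderiv ℝ f (x - t + s • t) t‖ₑ ≤ ∫⁻ s in Icc (0 : ℝ) 1, ‖fderiv ℝ f (x - t + s • t) t‖ₑ := by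
    refine (enorm_integral_le_lintegral_enorm _).trans (lintegral_mono_set Ioc_subset_Icc_self)
  have h2 : ∀ s : ℝ, ‖fderiv ℝ f (x - t + s • t) t‖ₑ ≤ ‖fderiv ℝ f (x - t + s • t)‖ₑ * ENNReal.ofReal ‖t‖ := by
    intro s
    rw [← ofReal_norm, ← ofReal_norm, ← ENNReal.ofReal_mul (norm_nonneg _)]
    exact ENNReal.ofReal_le_ofReal (le_opNorm _ _)
  have hmeas : AEMeasurable (fun s : ℝ => ‖fderiv ℝ f (x - t + s • t)‖ₑ * ENNReal.ofReal ‖t‖) (volume.restrict (Icc (0 : ℝ) 1)) :=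
    (((hf.continuous_fderiv one_ne_zero).comp hl2).measurable.enorm.mul_const _).aemeasurable
  calc ‖∫ s in Ioc (0 : ℝ) 1, fderiv ℝ f (x - t + s • t) t‖ₑ ^ 2
      ≤ (∫⁻ s in Icc (0 : ℝ) 1, ‖fderiv ℝ f (x - t + s • t)‖ₑ * ENNReal.ofReal ‖t‖) ^ 2 :=
        pow_le_pow_left' (h1.trans (lintegral_mono fun s => h2 s)) 2
    _ ≤ ∫⁻ s in Icc (0 : ℝ) 1, (‖fderiv ℝ f (x - t + s • t)‖ₑ * ENNReal.ofReal ‖t‖) ^ 2 := lintegral_Icc_sq_le hmeas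
    _ = ENNReal.ofReal (‖t‖ ^ 2) * ∫⁻ s in Icc (0 : ℝ) 1, ‖fderiv ℝ f (x - t + s • t)‖ₑ ^ 2 := by
        rw [← lintegral_const_mul' _ _ ENNReal.ofReal_ne_top]
        refine lintegral_congr fun s => ?_
        rw [mul_pow, mul_comm, ENNReal.ofReal_pow (norm_nonneg _)]

/-- Jensen for a (sub-)probability measure in `ℝ≥0∞` form: `(∫⁻ g dν)² ≤ ∫⁻ g² dν` if `ν(univ) ≤ 1`. [folklore] -/
theorem lintegral_sq_le_of_measure_univ_le_one {α : Type*} [MeasurableSpace α] (ν : Measure α) (hν : ν univ ≤ 1)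
    {g : α → ℝ≥0∞} (hg : AEMeasurable g ν) : (∫⁻ s, g s ∂ν) ^ 2 ≤ ∫⁻ s, g s ^ 2 ∂ν := by
  have hH := ENNReal.lintegral_mul_le_Lp_mul_Lq ν Real.HolderConjugate.two_two hg (g := fun _ => 1) aemeasurable_const
  simp only [Pi.mul_apply, mul_one, lintegral_const, ENNReal.rpow_two, one_pow, one_mul] at hH
  have h1 : (ν univ) ^ (1 / (2 : ℝ)) ≤ 1 := by
    calc (ν univ) ^ (1 / (2 : ℝ)) ≤ (1 : ℝ≥0∞) ^ (1 / (2 : ℝ)) := ENNReal.rpow_le_rpow hν (by norm_num)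
      _ = 1 := ENNReal.one_rpow _
  have h2 : ∫⁻ s, g s ∂ν ≤ (∫⁻ s, g s ^ 2 ∂ν) ^ (1 / (2 : ℝ)) :=
    hH.trans ((mul_le_mul' le_rfl h1).trans_eq (mul_one _))
  calc (∫⁻ s, g s ∂ν) ^ 2 ≤ ((∫⁻ s, g s ^ 2 ∂ν) ^ (1 / (2 : ℝ))) ^ 2 := pow_le_pow_left' h2 2
    _ = ∫⁻ s, g s ^ 2 ∂ν := by rw [← ENNReal.rpow_natCast, ← ENNReal.rpow_mul]; norm_num

/-- Translated balls: `∫⁻_{B(x₀,L)} g(x − a) dx = ∫⁻_{B(x₀ − a, L)} g`. [folklore] -/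
theorem lintegral_ball_comp_sub (g : E3 → ℝ≥0∞) (x₀ a : E3) (L : ℝ) :
    ∫⁻ x in ball x₀ L, g (x - a) = ∫⁻ y in ball (x₀ - a) L, g y := by
  rw [← lintegral_indicator measurableSet_ball, ← lintegral_indicator measurableSet_ball]
  have h : (ball x₀ L).indicator (fun x => g (x - a)) = fun x => (ball (x₀ - a) L).indicator g (x - a) := by
    funext x
    have hiff : x ∈ ball x₀ L ↔ x - a ∈ ball (x₀ - a) L := by rw [mem_ball, mem_ball, dist_sub_right]
    by_cases hx : x ∈ ball x₀ L
    · rw [indicator_of_mem hx, indicator_of_mem (hiff.1 hx)]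
    · rw [indicator_of_notMem hx, indicator_of_notMem (fun h => hx (hiff.2 h))]
  rw [h, lintegral_sub_right_eq_self]

/-- **Translation estimate in `L²(B)`**: `∫⁻_{B(x₀,L)} ‖f − f(· − t)‖ₑ² ≤ ‖t‖² ∫⁻_{B(x₀,L+‖t‖)} ‖Df‖ₑ²` for `f ∈ C¹`. [folklore] -/
theorem lintegral_ball_sub_translate_sq_le (hf : ContDiff ℝ 1 f) (x₀ t : E3) (L : ℝ) :
    ∫⁻ x in ball x₀ L, ‖f x - f (x - t)‖ₑ ^ 2 ≤
      ENNReal.ofReal (‖t‖ ^ 2) * ∫⁻ y in ball x₀ (L + ‖t‖), ‖fderiv ℝ f y‖ₑ ^ 2 := by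
  set h : E3 → ℝ → ℝ≥0∞ := fun x s => ‖fderiv ℝ f (x - t + s • t)‖ₑ ^ 2 with hh
  have hDc : Continuous (fderiv ℝ f) := hf.continuous_fderiv one_ne_zero
  have hmeas : AEMeasurable (uncurry h) ((volume.restrict (ball x₀ L)).prod (volume.restrict (Icc (0 : ℝ) 1))) := by
    have hc : Continuous fun p : E3 × ℝ => fderiv ℝ f (p.1 - t + p.2 • t) := hDc.comp (by fun_prop)
    exact (hc.measurable.enorm.pow_const 2).aemeasurable
  -- inner bound after swapping the integrals
  have hinner : ∀ s ∈ Icc (0 : ℝ) 1, ∫⁻ x in ball x₀ L, h x s ≤ ∫⁻ y in ball x₀ (L + ‖t‖), ‖fderiv ℝ f y‖ₑ ^ 2 := by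
    intro s hs
    have he : ∀ x : E3, x - t + s • t = x - (1 - s) • t := fun x => by rw [sub_smul, one_smul]; abel
    simp only [hh, he]
    rw [lintegral_ball_comp_sub (fun y => ‖fderiv ℝ f y‖ₑ ^ 2) x₀ ((1 - s) • t) L]
    refine lintegral_mono_set (ball_subset_ball' ?_)
    rw [dist_eq_norm, sub_sub_cancel_left, norm_neg, norm_smul, Real.norm_eq_abs, abs_of_nonneg (by linarith [hs.2])]
    nlinarith [hs.1, hs.2, norm_nonneg t]
  calc ∫⁻ x in ball x₀ L, ‖f x - f (x - t)‖ₑ ^ 2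
      ≤ ∫⁻ x in ball x₀ L, ENNReal.ofReal (‖t‖ ^ 2) * ∫⁻ s in Icc (0 : ℝ) 1, h x s :=
        lintegral_mono fun x => enorm_sub_translate_sq_le hf x t
    _ = ENNReal.ofReal (‖t‖ ^ 2) * ∫⁻ s in Icc (0 : ℝ) 1, ∫⁻ x in ball x₀ L, h x s := by
        rw [lintegral_const_mul' _ _ ENNReal.ofReal_ne_top, lintegral_lintegral_swap hmeas]
    _ ≤ ENNReal.ofReal (‖t‖ ^ 2) * ∫⁻ s in Icc (0 : ℝ) 1, ∫⁻ y in ball x₀ (L + ‖t‖), ‖fderiv ℝ f y‖ₑ ^ 2 := by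
        refine mul_le_mul' le_rfl (setLIntegral_mono' measurableSet_Icc fun s hs => hinner s hs)
    _ = ENNReal.ofReal (‖t‖ ^ 2) * ∫⁻ y in ball x₀ (L + ‖t‖), ‖fderiv ℝ f y‖ₑ ^ 2 := by
        rw [setLIntegral_const, Real.volume_Icc, sub_zero, ENNReal.ofReal_one, mul_one]

/-- **Mollification estimate, pointwise (Jensen)**: `‖f x − (φ.normed ⋆ f)(x)‖ₑ² ≤ ∫⁻ φ.normed(t) ‖f x − f(x − t)‖ₑ² dt` for continuous `f`.
[folklore] -/
theorem enorm_sub_normed_convolution_sq_le (φ : ContDiffBump (0 : E3)) (hf : Continuous f) (x : E3) :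
    ‖f x - (φ.normed volume ⋆[lsmul ℝ ℝ, volume] f) x‖ₑ ^ 2 ≤
      ∫⁻ t, ENNReal.ofReal (φ.normed volume t) * ‖f x - f (x - t)‖ₑ ^ 2 := by
  -- `f x − (φ ⋆ f)(x) = ∫ φ(t) • (f x − f(x − t)) dt`
  have hi1 : Integrable (fun t => φ.normed volume t • f x) volume := φ.integrable_normed.smul_const _
  have hi2 : Integrable (fun t => φ.normed volume t • f (x - t)) volume :=
    ((φ.contDiff_normed (n := 0)).continuous.smul (hf.comp (continuous_const.sub continuous_id))).integrable_of_hasCompactSupport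
      (φ.hasCompactSupport_normed.smul_right)
  have hrep : f x - (φ.normed volume ⋆[lsmul ℝ ℝ, volume] f) x = ∫ t, φ.normed volume t • (f x - f (x - t)) := by
    rw [convolution_def]
    simp only [lsmul_apply, smul_sub]
    rw [integral_sub hi1 hi2, integral_smul_const, φ.integral_normed, one_smul]
  rw [hrep]
  -- Jensen for the probability density `φ.normed`
  set ν : Measure E3 := volume.withDensity fun t => ENNReal.ofReal (φ.normed volume t) with hν
  have hdm : Measurable fun t => ENNReal.ofReal (φ.normed volume t) :=
    ENNReal.measurable_ofReal.comp (φ.contDiff_normed (n := 0)).continuous.measurable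
  have hν1 : ν univ ≤ 1 := by
    rw [hν, withDensity_apply _ MeasurableSet.univ, Measure.restrict_univ]
    have h := FunctionSpaces.lintegral_enorm_normed (E := E3) φ
    have h' : ∀ y, ‖φ.normed volume y‖ₑ = ENNReal.ofReal (φ.normed volume y) := fun y =>
      Real.enorm_eq_ofReal (φ.nonneg_normed y)
    simp_rw [h'] at h
    exact h.le
  have hgm : Measurable fun t => ‖f x - f (x - t)‖ₑ :=
    (continuous_const.sub (hf.comp (continuous_const.sub continuous_id))).measurable.enorm
  calc ‖∫ t, φ.normed volume t • (f x - f (x - t))‖ₑ ^ 2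
      ≤ (∫⁻ t, ‖φ.normed volume t • (f x - f (x - t))‖ₑ) ^ 2 := pow_le_pow_left' (enorm_integral_le_lintegral_enorm _) 2
    _ = (∫⁻ t, ‖f x - f (x - t)‖ₑ ∂ν) ^ 2 := by
        rw [hν, lintegral_withDensity_eq_lintegral_mul _ hdm hgm]
        congr 1
        refine lintegral_congr fun t => ?_
        rw [Pi.mul_apply, enorm_smul, Real.enorm_eq_ofReal (φ.nonneg_normed t)]
    _ ≤ ∫⁻ t, ‖f x - f (x - t)‖ₑ ^ 2 ∂ν := lintegral_sq_le_of_measure_univ_le_one ν hν1 hgm.aemeasurable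
    _ = ∫⁻ t, ENNReal.ofReal (φ.normed volume t) * ‖f x - f (x - t)‖ₑ ^ 2 := by
        rw [hν, lintegral_withDensity_eq_lintegral_mul _ hdm (hgm.pow_const 2)]
        rfl

/-- **Mollification estimate in `L²(B)`**: `∫⁻_{B(x₀,L)} ‖f − φ.normed ⋆ f‖ₑ² ≤ rOut² · ∫⁻_{B(x₀,L+rOut)} ‖Df‖ₑ²` for `f ∈ C¹`. [folklore] -/
theorem lintegral_ball_sub_normed_convolution_sq_le (φ : ContDiffBump (0 : E3)) (hf : ContDiff ℝ 1 f) (x₀ : E3) (L : ℝ) :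
    ∫⁻ x in ball x₀ L, ‖f x - (φ.normed volume ⋆[lsmul ℝ ℝ, volume] f) x‖ₑ ^ 2 ≤
      ENNReal.ofReal (φ.rOut ^ 2) * ∫⁻ y in ball x₀ (L + φ.rOut), ‖fderiv ℝ f y‖ₑ ^ 2 := by
  set C : ℝ≥0∞ := ENNReal.ofReal (φ.rOut ^ 2) * ∫⁻ y in ball x₀ (L + φ.rOut), ‖fderiv ℝ f y‖ₑ ^ 2 with hC
  have hfc : Continuous f := hf.continuous
  set h : E3 → E3 → ℝ≥0∞ := fun x t => ENNReal.ofReal (φ.normed volume t) * ‖f x - f (x - t)‖ₑ ^ 2 with hh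
  have hdm : Measurable fun t => ENNReal.ofReal (φ.normed volume t) :=
    ENNReal.measurable_ofReal.comp (φ.contDiff_normed (n := 0)).continuous.measurable
  have hmeas : AEMeasurable (uncurry h) ((volume.restrict (ball x₀ L)).prod volume) := by
    have hc : Continuous fun p : E3 × E3 => f p.1 - f (p.1 - p.2) :=
      (hfc.comp continuous_fst).sub (hfc.comp (continuous_fst.sub continuous_snd))
    exact ((hdm.comp measurable_snd).mul (hc.measurable.enorm.pow_const 2)).aemeasurable
  -- for each `t`: `φ(t) ∫⁻_B ‖f − f(·−t)‖ₑ² ≤ φ(t) · C`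
  have hpt : ∀ t, ENNReal.ofReal (φ.normed volume t) * ∫⁻ x in ball x₀ L, ‖f x - f (x - t)‖ₑ ^ 2 ≤
      ENNReal.ofReal (φ.normed volume t) * C := by
    intro t
    by_cases ht : φ.normed volume t = 0
    · rw [ht, ENNReal.ofReal_zero, zero_mul, zero_mul]
    · have ht' : t ∈ Function.support (φ.normed volume) := ht
      rw [φ.support_normed_eq, mem_ball_zero_iff] at ht'
      refine mul_le_mul' le_rfl ((lintegral_ball_sub_translate_sq_le hf x₀ t L).trans ?_)
      refine mul_le_mul' (ENNReal.ofReal_le_ofReal (pow_le_pow_left₀ (norm_nonneg _) ht'.le 2))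
        (lintegral_mono_set (ball_subset_ball (by linarith)))
  have hnorm1 : ∫⁻ t, ENNReal.ofReal (φ.normed volume t) = 1 := by
    have h := FunctionSpaces.lintegral_enorm_normed (E := E3) φ
    have h' : ∀ y, ‖φ.normed volume y‖ₑ = ENNReal.ofReal (φ.normed volume y) := fun y =>
      Real.enorm_eq_ofReal (φ.nonneg_normed y)
    simp_rw [h'] at h
    exact h
  calc ∫⁻ x in ball x₀ L, ‖f x - (φ.normed volume ⋆[lsmul ℝ ℝ, volume] f) x‖ₑ ^ 2
      ≤ ∫⁻ x in ball x₀ L, ∫⁻ t, h x t := lintegral_mono fun x => enorm_sub_normed_convolution_sq_le φ hfc x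
    _ = ∫⁻ t, ∫⁻ x in ball x₀ L, h x t := lintegral_lintegral_swap hmeas
    _ = ∫⁻ t, ENNReal.ofReal (φ.normed volume t) * ∫⁻ x in ball x₀ L, ‖f x - f (x - t)‖ₑ ^ 2 := by
        refine lintegral_congr fun t => ?_
        rw [hh]; dsimp only
        rw [lintegral_const_mul' _ _ ENNReal.ofReal_ne_top]
    _ ≤ ∫⁻ t, ENNReal.ofReal (φ.normed volume t) * C := lintegral_mono hpt
    _ = C := by rw [lintegral_mul_const C hdm, hnorm1, one_mul]

end ExtremiserLiouville

end Summit.NavierStokesRegularity.NavierStokesRegularity.Theorems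

end
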